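import Literature.MathematicalPhysics.QuantumFieldTheory.Balaban1983to89.B14FlowStep

/-!
# `Balaban1983to89.B14FlowStepPerturbed` — T11.F, the SECOND-ORDER IDENTIFICATION POINT: both readings close from
(AvAF) plus a layer-sum-controlled perturbation; the WEAKER p. 278 threshold
(cell `pub-balaban`, unit `b2b-balaban-strat-b14` = strategist of the located step B14 p. 255 / β sub-cell CO-LEAD,
[III] side; node T11.F; companion of `B14FlowStep` §K / §PowerLaw — a separate module only because `B14FlowStep.lean`
has reached the gate's file-size cap; cell GAPS G-B14s-22 (the B14 §3 lineage's answer to this lineage's ASK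
G-sb14-3), MISSING-B14.md v6 §8 C13/C14, BETA-SPEC.md §5.9)

HONEST FRAMING (cell rule, page 1 of everything): discharging the β sub-cell's wall makes Bałaban's UV stability
UNCONDITIONAL in the interval-hypothesis sense of [Balaban1989LargeFieldII] p. 355 — a real constructive-QFT result;
it is NOT the continuum limit and NOT the Clay problem.  THIS MODULE DISCHARGES NOTHING: every theorem below is
bookkeeping over real sequences.  Nothing about Bałaban's β-functions (1.22) is asserted, and the perturbation shape
`|δ_k| ≤ D·g_k²·Σ_{j=1}^{k} g_j^κ` consumed below is a HYPOTHESIS — the shape of a RECONSTRUCTION by the cell's B14 §3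
lineage (GAPS G-B14s-22 §3(b)/§4, "order of magnitude only"), printed nowhere, asserted by nobody.

ABSOLUTE RULE (cell rule, verbatim): "No internally-minted statement may enter as a cited fact. Every hypothesis is
either kernel-proved in this package or a verbatim quotation of a PUBLISHED theorem with page reference. The
manuscript(s) under audit are NOT citable for their own disputed steps — they are the thing under adjudication;
programme-internal (2001/route/tribunal) claims are never citable."

CITATION HEADER (lean-in-tree rule 2026-08-18).  Source under audit: T. Bałaban, *Convergent renormalization
expansions for lattice gauge theories*, Commun. Math. Phys. **119**, 243–285 (1988) [Balaban1988Convergent] (cell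
paper B14 = [III]; journal page = PDF page + 242; renders
`HOME/b2b-balaban-ref1/pages/1988-cmp119-convergent-renormalization/…-p017-x2.png`, `…-p029-x2.png`, `…-p036-x2.png`,
`…-p037-x2.png`, `…-p040-x2.png`, `…-p041-x2.png` and `…-p018-x2.png` READ for this module by this unit, 2026-08-18); T. Bałaban,
*Renormalization group approach to lattice gauge field theories. I*, Commun. Math. Phys. **109**, 249–301 (1987)
[Balaban1987RG1] (B12 = [I]; (0.20) p. 256 and "uniformly bounded on this interval" p. 264 — through `Setup.Flow` and
`B14FlowStep`).  What is reproduced: six sentences of [III] §2–§3 quoted verbatim in the next paragraph (LOCATED, not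
adjudicated); the displays (2.6)–(2.9) pp. 255–256 and (2.46) p. 263 enter through `B14` / `B14FlowStep`, whose
headers carry them verbatim; each theorem carries the cite of the display it concerns.

WHAT PRINT SAYS (verbatim, renders as above).  p. 259 [17], after (2.24): *"Here the coupling constants g_{j−1} are
defined as in (I.0.20)"*.  p. 271 [29]: *"The sum of the two expressions, 𝐑′_k and 𝐄_k, is denoted also by 𝐄_k."*
p. 278 [36]: *"The terms of the sum above satisfy the bounds (2.42), with the constant B₀ replaced by O(p₀³(g_k)). Of
course the integration with respect to t preserves the form of the representation, and the multiplication by g_k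
yields small bounds."* and *"The important remark is that the terms 𝐄₀^{(k+1)}(Λ_{k+1},X,z) of this representation,
for X ⊂ Λ_{k+1}, do not depend on Λ_{k+1}, and coincide with the corresponding terms arising from the expressions
defined on the whole lattice, i.e. in the framework of [I]."*  p. 279 [37]: *"The coupling constant renormalization
is performed by subtracting β_{k+1}(g_k)A(φ_{k+1},U_{k+1}) from 𝐄^{(k+1)} − 𝐄^{(k+1)}(1), and by replacing the
function g_k^{−2}(·) in the action A(g_k^{−2}(·),U_{k+1}) by g_{k+1}^{−2}(·) defined by the equation (2.24) with
j = k+1."*  p. 282 [40], after (3.61): *"The last identity can be considered as a possible definition of the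
β-function. Now we prove that it coincides with the definition (I.1.22)."*  p. 283 [41], (3.64): *"β′_j = … = β_j.
This is the required equality."*
THE LOCATED POINT (GAPS G-B14s-22 §4; objection-LOCATING, nothing adjudicated).  After the merge `𝐑′_k ⊂ 𝐄_k` (p. 271)
the (k+1)-th step generates, in every term of (2.18) with a large-field history, 𝐑′_k-derived fluctuation pieces
booked into `𝐄^{(k+1)}` (pp. 272–274, 278–279); their second-order part is a MARGINAL `F²` piece whose coefficient
`δβ_{k+1}` is history- and 𝐑-dependent, while p. 282–283 identify the subtracted coefficient with the 𝐑-free objects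
of [I] ((I.1.22)) for the whole-lattice family.  Print displays neither READING (α) — `β_{k+1}` := [I]'s formulas
applied to [III]'s own family, `δβ` absorbed into the flow (2.24), i.e. into Theorem 1's hypothesis on `{g_j}` — nor
READING (β) — `β_{k+1}` := [I]'s function, `δβ` an undisplayed marginal remainder re-booked into `𝐑^{(j)}`, where
(2.31)/(2.44) must absorb it.  The B14 §3 lineage's RECONSTRUCTION of the sizes (order of magnitude only, NOT printed;
G-B14s-22 §3(b)/(d)/§4): `|δβ_{k+1}| ≲ g_k²·polylog·Σ_{j≤k₁} g_j^{κ₀}K_{j,k}`, `K_{j,k} = O((ε_k/α_{0,j})²)` with NO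
factor `L^{−(k−j)}` — a FLAT layer sum (the factor `ρ_{j,k} ∝ L^{−(k−j)}` of this lineage's ASK G-sb14-3 belongs to the
`𝐑″` range only and is WITHDRAWN for `j ≤ k₁`); and, for the reproduction of `E₀` at p. 278, the threshold
`Σ_{j≤k} g_j^{κ₀−2} ≤ c′E₀·g_k^{−a}·polylog(g_k)⁻¹` — WEAKER than the middle member of (2.46), but uniform in the number
of steps.
WHAT THIS MODULE PROVES (over real sequences; the shape `|δ_k| ≤ D·g_k²·Σ_{j=1}^{k} g_j^κ` is the reconstruction's
shape with all logarithms and the `K_{j,k}` absorbed into `D` and the exponent `κ`):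
(L-a) `weakLayerBound_unbounded_printOnly` — for EVERY interval bound `γ > 0`, every `C` and all exponents `a, κ` the
  constant flow `g ≡ γ`, `β ≡ 0` (solving (0.20), sign `0 ≤ β ≤ β′`) violates `Σ_{j≤K} g_j^κ ≤ C·g_K^{−a}` at some `K`:
  the weaker p. 278 threshold is no more a consequence of (0.20) + interval + sign than the per-layer form of
  `B14FlowStep` §K (`layerSum_unbounded_printOnly` is the case `a = 0`); under `SumIneq246` (delivered by averaged
  asymptotic freedom, `B14FlowStep.sumIneq246_of_avgAF`) it holds trivially (`weakLayerBound_of_sum246`).  So the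
  cell's census row C13(ii) stands, with the weaker threshold.
(L-b) READING (α): `absDelta_le_of_perturbedSplit`, `avgAF_of_perturbedSplit`, `flowControl_of_perturbedSplit`,
  `flowControl_of_perturbedEventual` — a BOOTSTRAP IN THE SCALE.  If the realised β-values split as
  `β_{j+1}(g_j) = βᴵ_j + δ_j` with (AvAF) `b(n−m) − B ≤ Σ_{[m,n)} βᴵ_j` for the [I]-part along the run (which the β
  sub-cell's box-level forms deliver along EVERY run in the box — eventual / limit / bounded-oscillation forms,
  `B14FlowStep.avgAF_of_eventualLower`, `avgAF_seq_of_eventualLower` below, cell module `Beta.FlowConsumers`),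
  `|δ_k| ≤ D·g_k²·Σ_{j=1}^{k} g_j^κ` (`κ ≥ 6`, `D ≥ 0`) and the γ-smallness `Bγ² ≤ 1/2`, `(√2)^{κ−6}(4γ⁴/b + γ⁶) < 1`,
  `Dγ² ≤ b/2` (`γ ≤ 1`), then by strong induction on `k` — the layer sum at `k` is `< g_k^{κ−6} ≤ 1` by
  `sumIneq246_of_avgAF` for the horizon `k`, whose (AvAF) with slope `b/2` uses only `|δ_j| ≤ b/2` for `j < k`
  (`avgAF_of_split_absLe`) — `|δ_k| ≤ b/2` for ALL `k < K`; hence (AvAF) with slope `b/2` and the same defect for the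
  perturbed flow, `SumIneq246`, and, with a printed-type upper bound `βᴵ ≤ β′`, ALL of (2.6)–(2.9) with the printed
  constants for the bound `β′ + b/2` (`B14FlowStep.flowControl_of_avgAF`).  Reading (α) thus consumes NO β-function
  input beyond the sub-cell's (AvAF) for the [I]-part; its price is the (Δβ)-shape bound and γ-smallness (the [I]-side
  endpoint existence for the perturbed map needs in addition the per-scale continuity of `δ` in the couplings —
  routine in the cell's `FlowStepRuns` / `Beta.BetaContinuity` sense, not typed here).
(L-c) READING (β): `rebooked_le_of_sum246` — along a flow with `SumIneq246 F.g κ K` (from (AvAF)) the re-booked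
  coefficient obeys `D·g_k²·Σ_{j≤k} g_j^κ ≤ D·g_k^{κ−4}` (`k ≤ K`): a bound of the (2.31)/(2.44) shape `R₁g^{κ₀′}` with
  `κ₀′ = κ − 4` — the per-layer form of `B14FlowStep` §K (census row C13(i)) again, at the cost of the exponent
  ([Balaban1988Convergent] p. 260: *"κ₀ can be chosen arbitrarily large"*).
CENSUS CONSEQUENCE (MISSING-B14.md v6 §8 C14, BETA-SPEC §5.9): the located identification point adds NO new input on
Bałaban's β-functions (1.22) to the [III]-side contract — under either reading every located consumer closes from
(AvAF) + explicit γ-smallness — and what it DOES add is one undisplayed estimate of B14 §3, the (Δβ)-shape bound on the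
`𝐑′_k`-derived marginal coefficient (owner: the B14 §3 lineage; a refinement of GAPS G-B14s-18, not a β-function
property).  Nothing here asserts that estimate, either booking, or anything about (1.22).  VALUE = typed census item /
kernel bookkeeping, NOT progress on any open problem.  0 sorry; no definition; no new hypothesis structure.
Vocabulary: `Setup.Flow`, `Flow.SatisfiesRG`, `Flow.InInterval`, `Setup.epsK`; `B14.FlowIneq26/27/28`, `B14.IsRj`;
`B14FlowStep.FlowIneq29`, `SumIneq246`, `SmallnessFor`, `avgAF_of_eventualLower`, `sumIneq246_of_avgAF`,
`flowControl_of_avgAF`, `layerSum_unbounded_printOnly`.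
-/

namespace Literature.MathematicalPhysics.QuantumFieldTheory.Balaban1983to89.B14FlowStepPerturbed

open Literature.MathematicalPhysics.QuantumFieldTheory.Balaban1983to89
open Literature.MathematicalPhysics.QuantumFieldTheory.Balaban1983to89.B14FlowStep

variable (F : Flow) (K : ℕ)

/-! ## (L-a) The WEAKER p. 278 threshold: necessity from print-only hypotheses fails; sufficiency from (2.46)₂ -/

/-- **(L-a) NECESSITY for the WEAKER p. 278 threshold.**  For every interval bound `γ > 0`, every constant `C` and
all exponents `a`, `κ`: the constant flow `g ≡ γ`, `β ≡ 0` solves (0.20), lies in `]0,γ]`, has `β = 0` (so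
`0 ≤ β ≤ β′` for any `β′ ≥ 0`), and at `K = ⌈C/γ^{a+κ}⌉₊ + 1` its layer sum `Σ_{j=1}^{K} g_j^κ = Kγ^κ` exceeds
`C·g_K^{−a} = C/γ^a`.  So no bound `Σ_{j≤k} g_j^κ ≤ C·g_k^{−a}` uniform in the number of steps follows from the
print-only hypotheses, however large `a` (cell GAPS G-B14s-22 §3(d); `B14FlowStep.layerSum_unbounded_printOnly` is
`a = 0`, `γ = 1/2`, `κ = 7`). [cite: Balaban1988Convergent, p.278 and (2.46) p.263] -/
theorem weakLayerBound_unbounded_printOnly {γ : ℝ} (hγ : 0 < γ) (C : ℝ) (a κ : ℕ) :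
    ∃ K : ℕ, ∃ F : Flow, F.SatisfiesRG K ∧ F.InInterval γ K ∧
      (∀ j, j < K → F.β (j + 1) (F.g j) = 0) ∧
      C / (F.g K) ^ a < ∑ j ∈ Finset.Icc 1 K, (F.g j) ^ κ := by
  refine ⟨⌈C / γ ^ (a + κ)⌉₊ + 1, ⟨fun _ => γ, fun _ _ => 0⟩, ?_, ?_, ?_, ?_⟩
  · intro k _; simp
  · intro k _; exact ⟨hγ, le_rfl⟩
  · intro j _; simp
  · simp only [Finset.sum_const, Nat.card_Icc, Nat.add_sub_cancel, nsmul_eq_mul]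
    push_cast
    have hγκ : 0 < γ ^ κ := pow_pos hγ κ
    have hceil : C / γ ^ (a + κ) ≤ (⌈C / γ ^ (a + κ)⌉₊ : ℝ) := Nat.le_ceil _
    have key : C / γ ^ a = C / γ ^ (a + κ) * γ ^ κ := by
      rw [pow_add, div_mul_eq_mul_div, mul_div_mul_right _ _ hγκ.ne']
    rw [key]
    exact mul_lt_mul_of_pos_right (by linarith) hγκ

/-- **(L-a) SUFFICIENCY**: under `SumIneq246` (delivered by averaged asymptotic freedom,
`B14FlowStep.sumIneq246_of_avgAF`) the weak threshold holds trivially — `Σ_{j≤k} g_j^κ < g_k^{κ−6} ≤ 1 ≤ C·g_k^{−a}`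
for `C ≥ 1` and couplings in `]0,γ] ⊂ ]0,1]`. [folklore] -/
theorem weakLayerBound_of_sum246 {γ C : ℝ} {κ a : ℕ} (hI : F.InInterval γ K) (hγ1 : γ ≤ 1) (hC : 1 ≤ C)
    (h : SumIneq246 F.g κ K) {k : ℕ} (hk : k ≤ K) :
    ∑ j ∈ Finset.Icc 1 k, (F.g j) ^ κ ≤ C / (F.g k) ^ a := by
  have hg := hI k hk
  have hg1 : F.g k ≤ 1 := hg.2.trans hγ1
  have h1 : ∑ j ∈ Finset.Icc 1 k, (F.g j) ^ κ < (F.g k) ^ (κ - 6) := h k hk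
  have h2 : (F.g k) ^ (κ - 6) ≤ 1 := pow_le_one₀ hg.1.le hg1
  have h3 : (1 : ℝ) ≤ C / (F.g k) ^ a := by
    rw [le_div_iff₀ (pow_pos hg.1 a)]
    have : (F.g k) ^ a ≤ 1 := pow_le_one₀ hg.1.le hg1
    linarith
  linarith

/-! ## (L-b) READING (α): perturbed flows — the bootstrap in the scale -/

/-- (L-b, helper) Along a split `β_{j+1}(g_j) = βᴵ_j + δ_j` of the realised values: (AvAF) with slope `b` and defect
`B` for the [I]-part and `|δ_j| ≤ θ` for `j < N` give (AvAF) with slope `b − θ` and the same defect up to the horizon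
`N ≤ K`. [folklore] -/
theorem avgAF_of_split_absLe {b B θ : ℝ} (βI δ : ℕ → ℝ) {N : ℕ} (hNK : N ≤ K)
    (hsplit : ∀ j, j < K → F.β (j + 1) (F.g j) = βI j + δ j)
    (havI : ∀ m n, m ≤ n → n ≤ K → b * ((n : ℝ) - m) - B ≤ ∑ j ∈ Finset.Ico m n, βI j)
    (hδ : ∀ j, j < N → |δ j| ≤ θ) :
    ∀ m n, m ≤ n → n ≤ N →
      (b - θ) * ((n : ℝ) - m) - B ≤ ∑ j ∈ Finset.Ico m n, F.β (j + 1) (F.g j) := by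
  intro m n hmn hnN
  have hsum : ∑ j ∈ Finset.Ico m n, F.β (j + 1) (F.g j) =
      ∑ j ∈ Finset.Ico m n, βI j + ∑ j ∈ Finset.Ico m n, δ j := by
    rw [← Finset.sum_add_distrib]
    refine Finset.sum_congr rfl fun j hj => ?_
    exact hsplit j (lt_of_lt_of_le (Finset.mem_Ico.mp hj).2 (hnN.trans hNK))
  have hδsum : -(θ * ((n : ℝ) - m)) ≤ ∑ j ∈ Finset.Ico m n, δ j := by
    have h1 : ∑ _j ∈ Finset.Ico m n, (-θ) ≤ ∑ j ∈ Finset.Ico m n, δ j := by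
      refine Finset.sum_le_sum fun j hj => ?_
      exact (abs_le.mp (hδ j (lt_of_lt_of_le (Finset.mem_Ico.mp hj).2 hnN))).1
    have h2 : ∑ _j ∈ Finset.Ico m n, (-θ) = -(θ * ((n : ℝ) - m)) := by
      rw [Finset.sum_const, Nat.card_Ico, nsmul_eq_mul, Nat.cast_sub hmn]; ring
    linarith
  have hIm := havI m n hmn (hnN.trans hNK)
  rw [hsum]
  have e : (b - θ) * ((n : ℝ) - m) = b * ((n : ℝ) - m) - θ * ((n : ℝ) - m) := by ring
  rw [e]
  linarith

/-- (L-b, helper) (AvAF) for a bare sequence from an EVENTUAL lower bound — the sequence form of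
`B14FlowStep.avgAF_of_eventualLower` (`βᴵ_j ≥ −β′` for all `j < K`, `≥ b` for `k₀ ≤ j < K` ⟹
`b(n−m) − (b+β′)k₀ ≤ Σ_{[m,n)} βᴵ_j`), as delivered along every run in the box by the sub-cell's eventual form
(EV-AF) plus the PRINTED two-sided bound "uniformly bounded on this interval" ([Balaban1987RG1] p. 264). [folklore] -/
theorem avgAF_seq_of_eventualLower (βI : ℕ → ℝ) {β' b : ℝ} {k₀ : ℕ} (hβ' : 0 ≤ β') (hb : 0 ≤ b)
    (hlo : ∀ j, j < K → -β' ≤ βI j) (htail : ∀ j, k₀ ≤ j → j < K → b ≤ βI j) :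
    ∀ m n, m ≤ n → n ≤ K → b * ((n : ℝ) - m) - (b + β') * k₀ ≤ ∑ j ∈ Finset.Ico m n, βI j := by
  let G : Flow := ⟨fun _ => 0, fun i _ => βI (i - 1)⟩
  have hG : ∀ j, G.β (j + 1) (G.g j) = βI j := fun j => by simp [G]
  intro m n hmn hnK
  have h := avgAF_of_eventualLower G K hβ' hb (fun j hj => by rw [hG]; exact hlo j hj)
    (fun j hj hjK => by rw [hG]; exact htail j hj hjK) m n hmn hnK
  simpa only [hG] using h

/-- **(L-b) READING (α): the bootstrap.**  Along a flow solving (0.20) in `]0,γ]` (`γ ≤ 1`) whose realised β-values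
split as `β_{j+1}(g_j) = βᴵ_j + δ_j` with (AvAF) `b(n−m) − B ≤ Σ_{[m,n)} βᴵ_j` (`b > 0`) for the [I]-part and a
perturbation controlled by the FLAT layer sum, `|δ_k| ≤ D·g_k²·Σ_{j=1}^{k} g_j^κ` (`D ≥ 0`, `κ ≥ 6`; the shape of the
B14 §3 lineage's reconstruction, GAPS G-B14s-22 §3(b)/§4 — a hypothesis, NOT printed), the γ-smallness `Bγ² ≤ 1/2`,
`(√2)^{κ−6}(2γ⁴/(b/2) + γ⁶) < 1`, `Dγ² ≤ b/2` forces `|δ_k| ≤ b/2` for EVERY `k < K` — by strong induction on `k`: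
the induction hypothesis gives (AvAF) with slope `b/2` up to the horizon `k` (`avgAF_of_split_absLe`), hence
`Σ_{j≤k} g_j^κ < g_k^{κ−6} ≤ 1` (`sumIneq246_of_avgAF` for the horizon `k`), hence `|δ_k| ≤ Dg_k² ≤ Dγ² ≤ b/2`. [folklore] -/
theorem absDelta_le_of_perturbedSplit {γ b B D : ℝ} {κ : ℕ} (βI δ : ℕ → ℝ)
    (hrg : F.SatisfiesRG K) (hI : F.InInterval γ K) (hγ1 : γ ≤ 1)
    (hsplit : ∀ j, j < K → F.β (j + 1) (F.g j) = βI j + δ j) (hb : 0 < b)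
    (havI : ∀ m n, m ≤ n → n ≤ K → b * ((n : ℝ) - m) - B ≤ ∑ j ∈ Finset.Ico m n, βI j)
    (hD : 0 ≤ D) (hδ : ∀ k, k < K → |δ k| ≤ D * (F.g k) ^ 2 * ∑ j ∈ Finset.Icc 1 k, (F.g j) ^ κ)
    (hκ : 6 ≤ κ) (hBγ : B * γ ^ 2 ≤ 1 / 2)
    (hsmall : Real.sqrt 2 ^ (κ - 6) * (2 * γ ^ 4 / (b / 2) + γ ^ 6) < 1) (hDγ : D * γ ^ 2 ≤ b / 2) :
    ∀ k, k < K → |δ k| ≤ b / 2 := by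
  intro k
  induction k using Nat.strong_induction_on with
  | _ k ih =>
    intro hkK
    have hkK' : k ≤ K := hkK.le
    -- (AvAF) with slope b/2 up to the horizon k, from the induction hypothesis
    have hav : ∀ m n, m ≤ n → n ≤ k →
        b / 2 * ((n : ℝ) - m) - B ≤ ∑ j ∈ Finset.Ico m n, F.β (j + 1) (F.g j) := by
      intro m n hmn hnk
      have h := avgAF_of_split_absLe F K βI δ hkK' hsplit havI
        (fun j hj => ih j hj (lt_trans hj hkK)) m n hmn hnk
      have e : b - b / 2 = b / 2 := by ring
      rw [e] at h
      exact h
    have hrgk : F.SatisfiesRG k := fun j hj => hrg j (lt_of_lt_of_le hj hkK')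
    have hIk : F.InInterval γ k := fun j hj => hI j (hj.trans hkK')
    have h246 : SumIneq246 F.g κ k :=
      sumIneq246_of_avgAF F k (half_pos hb) hrgk hIk hav hBγ hκ hsmall
    have hlayer : ∑ j ∈ Finset.Icc 1 k, (F.g j) ^ κ < (F.g k) ^ (κ - 6) := h246 k le_rfl
    have hgk := hI k hkK'
    have hle1 : (F.g k) ^ (κ - 6) ≤ 1 := pow_le_one₀ hgk.1.le (hgk.2.trans hγ1)
    have hg2 : (F.g k) ^ 2 ≤ γ ^ 2 := pow_le_pow_left₀ hgk.1.le hgk.2 2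
    have hDg : 0 ≤ D * (F.g k) ^ 2 := mul_nonneg hD (sq_nonneg _)
    calc |δ k| ≤ D * (F.g k) ^ 2 * ∑ j ∈ Finset.Icc 1 k, (F.g j) ^ κ := hδ k hkK
      _ ≤ D * (F.g k) ^ 2 * 1 := mul_le_mul_of_nonneg_left (by linarith) hDg
      _ ≤ D * γ ^ 2 := by rw [mul_one]; exact mul_le_mul_of_nonneg_left hg2 hD
      _ ≤ b / 2 := hDγ

/-- **(L-b) READING (α), at the level of the flow**: under the hypotheses of `absDelta_le_of_perturbedSplit` the
PERTURBED flow satisfies averaged asymptotic freedom with slope `b/2` and the same defect `B`, and the middle member of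
(2.46) (`SumIneq246`, exponent `κ`) — uniformly in `K`. [cite: Balaban1988Convergent, (2.46) p.263 and p.278] -/
theorem avgAF_of_perturbedSplit {γ b B D : ℝ} {κ : ℕ} (βI δ : ℕ → ℝ)
    (hrg : F.SatisfiesRG K) (hI : F.InInterval γ K) (hγ1 : γ ≤ 1)
    (hsplit : ∀ j, j < K → F.β (j + 1) (F.g j) = βI j + δ j) (hb : 0 < b)
    (havI : ∀ m n, m ≤ n → n ≤ K → b * ((n : ℝ) - m) - B ≤ ∑ j ∈ Finset.Ico m n, βI j)
    (hD : 0 ≤ D) (hδ : ∀ k, k < K → |δ k| ≤ D * (F.g k) ^ 2 * ∑ j ∈ Finset.Icc 1 k, (F.g j) ^ κ)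
    (hκ : 6 ≤ κ) (hBγ : B * γ ^ 2 ≤ 1 / 2)
    (hsmall : Real.sqrt 2 ^ (κ - 6) * (2 * γ ^ 4 / (b / 2) + γ ^ 6) < 1) (hDγ : D * γ ^ 2 ≤ b / 2) :
    (∀ m n, m ≤ n → n ≤ K → b / 2 * ((n : ℝ) - m) - B ≤ ∑ j ∈ Finset.Ico m n, F.β (j + 1) (F.g j)) ∧
      SumIneq246 F.g κ K := by
  have hδ' := absDelta_le_of_perturbedSplit F K βI δ hrg hI hγ1 hsplit hb havI hD hδ hκ hBγ hsmall hDγ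
  have hav : ∀ m n, m ≤ n → n ≤ K →
      b / 2 * ((n : ℝ) - m) - B ≤ ∑ j ∈ Finset.Ico m n, F.β (j + 1) (F.g j) := by
    intro m n hmn hnK
    have h := avgAF_of_split_absLe F K βI δ le_rfl hsplit havI hδ' m n hmn hnK
    have e : b - b / 2 = b / 2 := by ring
    rw [e] at h
    exact h
  exact ⟨hav, sumIneq246_of_avgAF F K (half_pos hb) hrg hI hav hBγ hκ hsmall⟩

/-- **(L-b) READING (α), T11.F headline**: for the perturbed flow ALL of (2.6)–(2.9) with the printed constants (for
the two-sided bound `β′ + b/2`, `βᴵ ≤ β′` being the printed-type upper bound of the [I]-part) AND the middle member of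
(2.46), from (AvAF) for the [I]-part, the (Δβ)-shape perturbation bound and explicit γ-smallness — NO further input on
the β-functions. [cite: Balaban1988Convergent, (2.6)–(2.9) pp.255–256, (2.46) p.263, p.278] -/
theorem flowControl_of_perturbedSplit {γ β' β₀ b B D : ℝ} {L p κ : ℕ}
    (S : SmallnessFor γ (β' + b / 2) β₀ L p) {A₀ : ℝ} (hA₀ : 0 ≤ A₀)
    (R : ℕ → ℕ) (hR : ∀ j, j ≤ K → B14.IsRj L p (F.g j) (R j)) (βI δ : ℕ → ℝ)
    (hrg : F.SatisfiesRG K) (hI : F.InInterval γ K)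
    (hsplit : ∀ j, j < K → F.β (j + 1) (F.g j) = βI j + δ j)
    (hubI : ∀ j, j < K → βI j ≤ β') (hb : 0 < b)
    (havI : ∀ m n, m ≤ n → n ≤ K → b * ((n : ℝ) - m) - B ≤ ∑ j ∈ Finset.Ico m n, βI j)
    (hD : 0 ≤ D) (hδ : ∀ k, k < K → |δ k| ≤ D * (F.g k) ^ 2 * ∑ j ∈ Finset.Icc 1 k, (F.g j) ^ κ)
    (hκ : 6 ≤ κ) (hBγ : B * γ ^ 2 ≤ β₀ * (2 + β₀)) (hBγ' : B * γ ^ 2 ≤ 1 / 2)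
    (hsmall : Real.sqrt 2 ^ (κ - 6) * (2 * γ ^ 4 / (b / 2) + γ ^ 6) < 1) (hDγ : D * γ ^ 2 ≤ b / 2) :
    (B14.FlowIneq26 F.g (β' + b / 2) β₀ K ∧ B14.FlowIneq27 F.g (β' + b / 2) β₀ p K ∧
      B14.FlowIneq28 (epsK A₀ p F) F.g (β' + b / 2) β₀ K ∧ FlowIneq29 R F.g L (β' + b / 2) β₀ K) ∧
      SumIneq246 F.g κ K := by
  have hγ1 : γ ≤ 1 := S.γ_lt_one.le
  have hδ' := absDelta_le_of_perturbedSplit F K βI δ hrg hI hγ1 hsplit hb havI hD hδ hκ hBγ' hsmall hDγ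
  have hav := (avgAF_of_perturbedSplit F K βI δ hrg hI hγ1 hsplit hb havI hD hδ hκ hBγ' hsmall hDγ).1
  have hub : ∀ j, j < K → F.β (j + 1) (F.g j) ≤ β' + b / 2 := by
    intro j hj
    rw [hsplit j hj]
    have := (abs_le.mp (hδ' j hj)).2
    linarith [hubI j hj]
  exact flowControl_of_avgAF F K S hA₀ R hR hrg hI hub (half_pos hb) hav hBγ hBγ' hκ hsmall

/-- **(L-b) READING (α), from the EVENTUAL form directly**: the [I]-part `βᴵ_j ≥ −β′` for all `j < K` and `≥ b > 0`
for `k₀ ≤ j < K` (what (EV-AF) plus the printed two-sided bound give along every run in the box), the (Δβ)-shape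
perturbation bound, and γ-smallness now depending on `k₀` (`(b+β′)k₀γ² ≤ β₀(2+β₀)`, `(b+β′)k₀γ² ≤ 1/2`,
`(√2)^{κ−6}(4γ⁴/b + γ⁶) < 1`, `Dγ² ≤ b/2`): ALL of (2.6)–(2.9) with the printed constants and (2.46) for the perturbed
flow. [cite: Balaban1988Convergent, (2.6)–(2.9) pp.255–256, (2.46) p.263, p.278] -/
theorem flowControl_of_perturbedEventual {γ β' β₀ b D : ℝ} {L p κ k₀ : ℕ}
    (S : SmallnessFor γ (β' + b / 2) β₀ L p) {A₀ : ℝ} (hA₀ : 0 ≤ A₀)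
    (R : ℕ → ℕ) (hR : ∀ j, j ≤ K → B14.IsRj L p (F.g j) (R j)) (βI δ : ℕ → ℝ)
    (hrg : F.SatisfiesRG K) (hI : F.InInterval γ K)
    (hsplit : ∀ j, j < K → F.β (j + 1) (F.g j) = βI j + δ j)
    (hβ' : 0 ≤ β') (hubI : ∀ j, j < K → βI j ≤ β') (hloI : ∀ j, j < K → -β' ≤ βI j) (hb : 0 < b)
    (htailI : ∀ j, k₀ ≤ j → j < K → b ≤ βI j)
    (hD : 0 ≤ D) (hδ : ∀ k, k < K → |δ k| ≤ D * (F.g k) ^ 2 * ∑ j ∈ Finset.Icc 1 k, (F.g j) ^ κ)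
    (hκ : 6 ≤ κ) (hk₀ : (b + β') * k₀ * γ ^ 2 ≤ β₀ * (2 + β₀)) (hk₀' : (b + β') * k₀ * γ ^ 2 ≤ 1 / 2)
    (hsmall : Real.sqrt 2 ^ (κ - 6) * (2 * γ ^ 4 / (b / 2) + γ ^ 6) < 1) (hDγ : D * γ ^ 2 ≤ b / 2) :
    (B14.FlowIneq26 F.g (β' + b / 2) β₀ K ∧ B14.FlowIneq27 F.g (β' + b / 2) β₀ p K ∧
      B14.FlowIneq28 (epsK A₀ p F) F.g (β' + b / 2) β₀ K ∧ FlowIneq29 R F.g L (β' + b / 2) β₀ K) ∧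
      SumIneq246 F.g κ K :=
  flowControl_of_perturbedSplit F K S hA₀ R hR βI δ hrg hI hsplit hubI hb
    (avgAF_seq_of_eventualLower K βI hβ' hb.le hloI htailI) hD hδ hκ hk₀ hk₀' hsmall hDγ

/-! ## (L-c) READING (β): the re-booked coefficient has the (2.31)/(2.44) shape -/

/-- **(L-c) READING (β): the re-booked coefficient is of the (2.31)/(2.44) shape.**  Along a flow with
`SumIneq246 F.g κ K` (e.g. from (AvAF), `B14FlowStep.sumIneq246_of_avgAF`; `κ ≥ 6`), for every `k ≤ K`:
`D·g_k²·Σ_{j=1}^{k} g_j^κ ≤ D·g_k^{κ−4}` — a per-current-point bound `R₁·g^{κ₀′}` with `κ₀′ = κ − 4`, i.e. the per-layer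
form of `B14FlowStep` §K (census row C13(i)) at the cost of the exponent. [cite: Balaban1988Convergent, (2.31) p.260, (2.44) p.263] -/
theorem rebooked_le_of_sum246 {D : ℝ} {κ : ℕ} (hD : 0 ≤ D) (hκ : 6 ≤ κ)
    (h : SumIneq246 F.g κ K) {k : ℕ} (hk : k ≤ K) :
    D * (F.g k) ^ 2 * ∑ j ∈ Finset.Icc 1 k, (F.g j) ^ κ ≤ D * (F.g k) ^ (κ - 4) := by
  have h1 : ∑ j ∈ Finset.Icc 1 k, (F.g j) ^ κ < (F.g k) ^ (κ - 6) := h k hk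
  have hDg : 0 ≤ D * (F.g k) ^ 2 := mul_nonneg hD (sq_nonneg _)
  have e : (F.g k) ^ 2 * (F.g k) ^ (κ - 6) = (F.g k) ^ (κ - 4) := by
    rw [← pow_add]; congr 1; omega
  calc D * (F.g k) ^ 2 * ∑ j ∈ Finset.Icc 1 k, (F.g j) ^ κ
      ≤ D * (F.g k) ^ 2 * (F.g k) ^ (κ - 6) := mul_le_mul_of_nonneg_left h1.le hDg
    _ = D * (F.g k) ^ (κ - 4) := by rw [mul_assoc, e]

end Literature.MathematicalPhysics.QuantumFieldTheory.Balaban1983to89.B14FlowStepPerturbed
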